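import Literature.AlgebraicGeometry.Frobenioids.PadicKummerSettingProofs
import Literature.AnabelianGeometry.AbsoluteAnabelian.AbsAnabProp121viiLayerDescent
import HarnessLib

/-!
# Frobenioids II, Theorem 2.4 (ii) — the invariant maps "induced on subquotients" ARE compatible:
# the assembly over the layer identifications `F_N(Aᵢ) ⥲ H²(Γ_{Eᵢ}, μ_N)`

Mochizuki, *The geometry of Frobenioids II*, Kyushu J. Math. **62** (2008) 401–460, §2, Theorem 2.4
(ii) p. 20 [cite: MochizukiFrdII2008, Thm 2.4 (ii) p.20]: "If the `Φᵢ` are fieldwise saturated,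
then the isomorphism `F_N(A₁) ⥲ F_N(A₂)` of (i) is compatible with the natural isomorphisms
`F_N(Aᵢ) ⥲ ℤ/Nℤ`", and its proof pp. 21–22: these isomorphisms are "induced on subquotients
[[NSW] 7.1.4] by the invariant `H²(Gᵢ, μ(K̄ᵢ^×)) ⥲ ℚ/ℤ`", whose compatibility with the map induced
by `Ψ` is [AbsAnab] Prop 1.2.1 (vii).

abc-iut cell, W12 = `plan/L1/SUBDAG-FrdII-Thm24.md` rows L22 `InvCompat` / L23 `SubquotientCompat` /
L24 `Assembly_ii` (holder abc-iut-w5-d201), PIECE C (generic form).  The typed statement `Thm24ii`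
(abc-iut-L1-t7, `PadicKummerSetting.lean`) carries the invariant maps `F_N(Aᵢ) ⥲ ℤ/Nℤ` as DATA
(`FNInvariant`); abc-iut-L1-d4's `Def22Context.Iso.thm24ii_of_invariant_compat` reduces it to the one
hypothesis `hinv`.  Here `hinv` is PROVED for invariants PINNED to the residue maps of the layers:
given additive identifications `Θᵢ : F_N(Aᵢ) → H²(Γ_{Eᵢ}, μ_N(Ēᵢ))` with the layers `Eᵢ/Kᵢ`
(`Gal(K̄ᵢ/Eᵢ⁰) = Hᵢ`) NATURAL along the context isomorphism `e` for every layer pair `(β, ψ̄_E)` over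
`(α, ψ̄)` (hypothesis `hΘ` — the homological-algebra transport of abc-iut-w5-d207's
`PadicKummerFNLayerTransport`, PIECE B, discharges it by name for `Θᵢ := Def22Context.fnLayerMap`),
invariants `invᵢ = inv_{Eᵢ} ∘ Θᵢ` with `inv_{Eᵢ}` the residue maps of the local fields `Eᵢ`
(`Prop121vii.IsInvariantMap`), and `ψ̄ : K̄₁^× ⥲ K̄₂^×` `α`-equivariant carrying absolute units to
units and `K₁`-uniformisers to `K₂`-uniformisers ([AbsAnab] Prop 1.2.1 (iii)/(iv); sub-DAG row L02),
`Thm24ii … (e.thm24Data N) inv₁ inv₂` holds — by [AbsAnab] Prop 1.2.1 (vii) for the layer pair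
(`Prop121vii.exists_layerTransport`, PIECE A).  Also: the pinned invariant EXISTS as soon as `Θ` is
bijective (`exists_fnInvariant_pinned`).  Proof-only; universe `0`; nothing here concerns [IUTchIII].
-/

noncomputable section

namespace Literature.AlgebraicGeometry.Frobenioids

namespace PadicKummer

open Field
open Literature.NumberTheory.GaloisRepresentations
open Literature.NumberTheory.GaloisRepresentations.LocalWeilDatum
open Literature.NumberTheory.GaloisRepresentations.DiscreteGaloisModule
open Literature.AnabelianGeometry.AbsoluteAnabelian
open Literature.AnabelianGeometry.AbsoluteAnabelian.Prop121vii

/-! ### The pinned invariant map exists -/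

/-- **The invariant "induced on subquotients" as a datum**: for an additive bijection
`Θ : F_N(A) ⥲ H` (the identification with `H²(Γ_E, μ_N)`) and an additive bijection `inv_E : H ⥲ ℤ/N`
(the residue map of the layer), there is an `FNInvariant` equal to `inv_E ∘ Θ`.
[cite: MochizukiFrdII2008, Thm 2.4 (ii) p.21] -/
theorem exists_fnInvariant_pinned {X : Def22Context} {N : ℕ} {H : Type} [AddCommGroup H]
    (Θ : FN X N →+ H) (hΘ : Function.Bijective Θ) (invE : H →+ ZMod N)
    (hinvE : Function.Bijective invE) :
    ∃ inv : FNInvariant X N, ∀ x, inv.toAddEquiv x = invE (Θ x) :=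
  ⟨⟨AddEquiv.ofBijective (invE.comp Θ) (hinvE.comp hΘ)⟩, fun _ => rfl⟩

/-! ### Theorem 2.4 (ii) over natural layer identifications -/

namespace Def22Context.Iso

variable {K₁ K₂ : Type} [Field K₁] [ValuativeRel K₁] [TopologicalSpace K₁]
  [IsNonarchimedeanLocalField K₁] [CharZero K₁] [Field K₂] [ValuativeRel K₂] [TopologicalSpace K₂]
  [IsNonarchimedeanLocalField K₂] [CharZero K₂]
  {X₁ X₂ : Def22Context} (e : Def22Context.Iso X₁ X₂) (N : ℕ) [NeZero N]
  (E₁ : Type) [Field E₁] [Algebra K₁ E₁] [FiniteDimensional K₁ E₁] [Finite (MuCarrier E₁ N)]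
  (E₂ : Type) [Field E₂] [Algebra K₂ E₂] [FiniteDimensional K₂ E₂] [Finite (MuCarrier E₂ N)]

/-- **Theorem 2.4 (ii)** (FrdII p. 20) **for invariants induced on subquotients by the residue
maps** — over natural layer identifications.  Data: an isomorphism `e` of the Definition 2.2 contexts
(induced by `Ψ`); the Galois pair `α : Γ_{K₁} ≅ Γ_{K₂}` carrying `Gal(K̄₁/E₁⁰)` onto `Gal(K̄₂/E₂⁰)`
and `ψ̄ : K̄₁^× ⥲ K̄₂^×` `α`-equivariant, absolute units to units, `K₁`-uniformisers to
`K₂`-uniformisers (what `Ψ` induces "by varying `Aᵢ` and reconstructing the multiplicative group of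
the field", p. 21; [AbsAnab] Prop 1.2.1 (iii)/(iv)); additive `Θᵢ : F_N(Aᵢ) → H²(Γ_{Eᵢ}, μ_N(Ēᵢ))`
natural along `e` for every layer pair `(β, ψ̄_E)` over `(α, ψ̄)` (`hΘ`); and invariants
`invᵢ = inv_{Eᵢ} ∘ Θᵢ` pinned to residue maps `inv_{Eᵢ}` of the local fields `Eᵢ` (prolonged
valuations).  Then "the isomorphism `F_N(A₁) ⥲ F_N(A₂)` of (i) is compatible with the natural
isomorphisms `F_N(Aᵢ) ⥲ ℤ/Nℤ`": `inv₂ ∘ (e.thm24Data N).isoFN = inv₁` — by [AbsAnab] Prop 1.2.1 (vii)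
for the layer pair (`Prop121vii.exists_layerTransport`). [cite: MochizukiFrdII2008, Thm 2.4 (ii) p.20] -/
theorem thm24ii_of_layerMaps (α : absoluteGaloisGroup K₁ ≃ₜ* absoluteGaloisGroup K₂)
    (hα : ∀ g : absoluteGaloisGroup K₁,
      g ∈ galFixing K₁ (embField K₁ E₁) ↔ α g ∈ galFixing K₂ (embField K₂ E₂))
    (ψ : (AlgebraicClosure K₁)ˣ ≃* (AlgebraicClosure K₂)ˣ) (hψ : IsAlphaEquivariant α ψ)
    (hu : PreservesAbsUnits ψ) (hunif : PreservesUniformizers ψ)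
    (Θ₁ : FN X₁ N →+ galoisCohomology (mu E₁ N) 2) (Θ₂ : FN X₂ N →+ galoisCohomology (mu E₂ N) 2)
    (hΘ : ∀ (β : absoluteGaloisGroup E₁ ≃ₜ* absoluteGaloisGroup E₂)
      (ψE : (AlgebraicClosure E₁)ˣ ≃* (AlgebraicClosure E₂)ˣ),
      (∀ σ, absGaloisRestrict K₂ E₂ (β σ) = α (absGaloisRestrict K₁ E₁ σ)) →
      (∀ x : (AlgebraicClosure K₁)ˣ,
        ψE (Units.map (absClosureEmbedding K₁ E₁).toRingHom.toMonoidHom x) =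
          Units.map (absClosureEmbedding K₂ E₂).toRingHom.toMonoidHom (ψ x)) →
      ∀ (hμ : IsEquivariantOver β (mu E₁ N) (mu E₂ N) (muCarrierMap ψE.toMonoidHom N))
        (x : FN X₁ N),
        Θ₂ (e.isoFN N x) =
          cohTransport β (mu E₁ N) (mu E₂ N) (muCarrierMap ψE.toMonoidHom N) hμ 2 (Θ₁ x))
    (invE₁ : galoisCohomology (mu E₁ N) 2 →+ ZMod N) (invE₂ : galoisCohomology (mu E₂ N) 2 →+ ZMod N)
    (fs₁ fs₂ : Prop) (inv₁ : FNInvariant X₁ N) (inv₂ : FNInvariant X₂ N)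
    (hpin₁ : ∀ x, inv₁.toAddEquiv x = invE₁ (Θ₁ x)) (hpin₂ : ∀ x, inv₂.toAddEquiv x = invE₂ (Θ₂ x)) :
    letI := FiniteExtension.valuativeRel K₁ E₁
    letI := FiniteExtension.topologicalSpace K₁ E₁
    haveI := FiniteExtension.isNonarchimedeanLocalField K₁ E₁
    letI := FiniteExtension.valuativeRel K₂ E₂
    letI := FiniteExtension.topologicalSpace K₂ E₂
    haveI := FiniteExtension.isNonarchimedeanLocalField K₂ E₂
    IsInvariantMap E₁ N invE₁ → IsInvariantMap E₂ N invE₂ →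
      Thm24ii X₁ X₂ N fs₁ fs₂ (e.thm24Data N) inv₁ inv₂ := by
  intro hE₁ hE₂
  obtain ⟨β, ψE, hβ, hψE, hβψ, -, hcompat⟩ :=
    Prop121vii.exists_layerTransport E₁ E₂ α hα ψ hψ hu hunif
  have hμ : IsEquivariantOver β (mu E₁ N) (mu E₂ N) (muCarrierMap ψE.toMonoidHom N) :=
    isEquivariantOver_muCarrierMap hβψ N
  refine e.thm24ii_of_invariant_compat N fs₁ fs₂ inv₁ inv₂ fun x => ?_
  rw [hpin₂, hpin₁]
  rw [hΘ β ψE hβ hψE hμ x, ← AddMonoidHom.comp_apply, hcompat N hμ invE₁ invE₂ hE₁ hE₂]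

end Def22Context.Iso

end PadicKummer

end Literature.AlgebraicGeometry.Frobenioids
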